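import Literature.Topology.FourManifolds.PlanarLefschetzBody
import Literature.Geometry.Symplectic.PlanarMonodromy
import Literature.Geometry.Symplectic.SteinDomain
import Literature.Geometry.Symplectic.PlanarContactBoundary
import HarnessLib

/-!
# The planar Stein dictionary: Wendl's theorem for a Stein bisection along a planar contact seam,
# PALF ⇒ Stein with the boundary open book supporting (Loi–Piergallini / Akbulut–Ozbagci + Gay), and
# Baykur's Stein bisection of the closed model of a block word — as named facts in the planar word
# calculus

Topic `Literature/Geometry/Symplectic`; namespace `Literature.Geometry.Symplectic`.  THREE NAMED
FACTS (D-0014; `def … : Prop`, nothing proved here) over: the tree's Stein domains and complex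
tangencies (`SteinStructure`, `contactPlane`, `boundaryPlaneField`, `SteinDomain.lean`,
`PlanarContactBoundary.lean`), open books with Giroux forms (`OpenBook`, `IsGirouxForm`,
`Supports`, `IsPlanar`), the planar monodromy vocabulary D-a (`OpenBook.HasPlanarMonodromy`,
`IsPositivelyFramed`, `PlanarMonodromy.lean`), the planar Lefschetz bodies / word manifolds D-b/D-d
(`IsPlanarLefschetzBody`, `IsPlanarWordManifold`, `PlanarLefschetzBody.lean`) and the registered
syntactic word calculus `PlanarWords` (`PlanarAchiralWords.lean`).  Consumer: crux
`ConvexBisection.PlanarAcyclicBisectionRigidity` (stmt-SmoothPoincare4-15086), line `Sketch`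
(programme G3 of `Cruxes/PlanarAcyclicBisectionRigidity/DictionaryDesign.md`): its dictionary stub is
the composition of these three facts with `supportedPlanarMonodromy` (F-a, `PlanarMonodromy.lean`)
and the topological readers of `Literature/Topology/FourManifolds/PlanarLefschetzBodyFacts.lean`.

A **Stein bisection along a common contact seam** of a 4-manifold `M` (the hypothesis of the whole
route `ConvexBisection`) is `M = e₁(W₁) ∪ e₂(W₂)` for two compact Stein domains `(Wᵢ, Jᵢ)` smoothly
embedded, covering `M`, meeting exactly in the images of their boundaries, with the complex
tangencies `ξᵢ = T∂Wᵢ ∩ Jᵢ T∂Wᵢ` pushed forward to the SAME plane field on the seam.  Then `W₂`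
enters `M` with the orientation opposite to its complex one (a plane field is a positive contact
structure for one orientation of the seam only), i.e. `M = W₁ ∪_ψ W̄₂` is a contact twisted double,
and the seam `Γ ≅ ∂W₁ ≅ ∂W₂` carries ONE contact structure `ξ` read from either side.

1. `wendl_planarSteinBisection` — **Wendl 2010, Thm. 1, for both halves of a Stein bisection along
   a planar seam, closed up.**  Wendl (Duke Math. J. 151 (2010), Thm. 1; arXiv:0806.3193): *"Suppose
   `(W, ω)` is a strong symplectic filling of a planar contact manifold `(M, ξ)`, and `π : M ∖ B → S¹`
   is a planar open book supporting `ξ`. Then `(W, ω)` is symplectically deformation equivalent to a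
   blow-up of a symplectic Lefschetz fibration `Π : W' → 𝔻` whose boundary open book is `π`"* — for
   a Stein (minimal) filling no blow-up occurs, and `W ≅ X(P; A)` for a POSITIVE factorisation `A` of
   the monodromy into right-handed Dehn twists about homotopically non-trivial curves of the page
   (Kas' handlebody of the PALF; Gompf–Stipsicz 1999, §8.2).  Applied to `(W₁, J₁)` and to
   `(W₂, J₂)` as fillings of the same `(Γ, ξ)` with the same positively framed planar open book of
   monodromy `(P_n, φ)` (`HasPlanarMonodromy`, `IsPositivelyFramed`: the chart reads the pages with
   their contact orientation, so both factorisations are positive factorisations of the SAME `φ` in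
   the same page coordinates), and closed up: the two Lefschetz fibrations over `D²` with the common
   boundary open book glue, page to page, to the achiral Lefschetz fibration over `S²` minus
   `♮ⁿ S¹ × B³` with word `A · B̄ʳᵉᵛ`, so `M = X̂(P_n; A B̄ʳᵉᵛ)` (Etnyre–Fuller 2006, Prop. 12 and proof of
   Thm. 1, p. 8; Baykur 2006, proof of Thm. 5.1; in the tree's words `IsPlanarWordManifold M n
   (blockForm A B)`).  Every simple closed curve of `P_n` is `g(c_[a,b])` for a framed-braid word `g`
   (change of coordinates, Farb–Margalit 2012, §1.3), so the factorisations are words of the calculus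
   with in-range syntax.
2. `planarLefschetzBody_stein_supported` — **PALF ⇒ Stein, boundary open book supporting**
   (Loi–Piergallini 2001, Thm. 1 / Akbulut–Ozbagci 2001, Thm. 5: a positive allowable Lefschetz
   fibration over `D²` with bounded fibres carries a Stein structure; Gay 2002, Prop. 2.8 / Etnyre
   2006, Thm. 5.6: its Kas boundary open book supports the induced contact structure): `X(P_n; A)`
   for a positive word of in-range (hence homotopically non-trivial) curves carries a Stein structure
   whose boundary complex tangencies, read on any boundary datum, are supported by a PLANAR open book
   with `n + 1` binding components (the Kas open book `(P_n, T_A)`).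
3. `baykur_planarSteinBisection` — **Baykur 2006, Thm. 5.1 (proof), for planar block words**: the
   closed model `X̂(P_n; A B̄ʳᵉᵛ)` of two positive factorisations `A`, `B` of one mapping class is a
   Stein bisection `X(P_n; A) ∪ X̄(P_n; B)` along a common contact seam — *"By [LP, AO], both `X₊` and
   `−X₋` admit Stein structures … the induced contact structures `ξ₊` on `∂X₊` and `ξ₋` on `∂(−X₋)` are
   isotopic"* (matched on the nose after a Gray isotopy), in the exact shape of the route's
   hypothesis (embeddings, cover, seams, equal pushed-forward complex tangencies), with the two
   pieces the planar Lefschetz bodies of `A` and `B`.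

All three are SPC4-independent theorems of the cited papers; none is within the tree's proved
depth (no Wendl compactness, no Legendrian realisation / Eliashberg 2-handles, no Gray stability on
the seam), cf. the sibling named facts `palf_stein_supportedByBoundaryOpenBook`
(`LefschetzSteinOpenBook.lean`) and `steinRealisation_of_sorted_modelsOnFibred`
(`LefschetzSteinRealisation.lean`) for the genus-`g` one-boundary-component page.

## References
* C. Wendl, *Strongly fillable contact manifolds and `J`-holomorphic foliations*, Duke Math. J. 151
  (2010), 337–384, Thm. 1 (arXiv:0806.3193). [Wendl2010]
* A. Loi, R. Piergallini, *Compact Stein surfaces with boundary as branched covers of `B⁴`*, Invent.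
  Math. 143 (2001), Thm. 1. [LoiPiergallini2001]
* S. Akbulut, B. Ozbagci, *Lefschetz fibrations on compact Stein surfaces*, Geom. Topol. 5 (2001),
  Thm. 5. [AkbulutOzbagci2001]
* D. T. Gay, *Explicit concave fillings of contact three-manifolds*, Math. Proc. Camb. Phil. Soc. 133
  (2002), Prop. 2.8. [Gay2002]
* J. B. Etnyre, *Lectures on open book decompositions and contact structures* (2006), Thm. 5.6.
  [Etnyre2006]
* R. İ. Baykur, *Kähler decomposition of 4-manifolds*, AGT 6 (2006), Thm. 5.1 and its proof, §5.
  [Baykur2006]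
* J. B. Etnyre, T. Fuller, *Realizing 4-manifolds as achiral Lefschetz fibrations*, IMRN 2006,
  Prop. 12, proof of Thm. 1. [EtnyreFuller2006]
* R. E. Gompf, A. I. Stipsicz, *4-Manifolds and Kirby Calculus* (1999), §8.2. [GompfStipsiczGSM1999]
* B. Farb, D. Margalit, *A Primer on Mapping Class Groups* (2012), §1.3. [FarbMargalit2012]
-/

noncomputable section

open Set Function
open scoped Manifold ContDiff
open Literature.Topology.FourManifolds
open Literature.Topology.FourManifolds.PlanarWords

namespace Literature.Geometry.Symplectic

/-- **Wendl's theorem for a Stein bisection along a planar contact seam, closed up** (Wendl 2010,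
Thm. 1, applied to both halves; Kas / Gompf–Stipsicz §8.2 for the handlebody; Etnyre–Fuller 2006
Prop. 12 / Baykur 2006 Thm. 5.1 (proof) for the closing; Farb–Margalit §1.3 for the syntax of
curves).  Let `M = e₁(W₁) ∪ e₂(W₂)` be a Stein bisection of the Hausdorff second-countable `C^∞`
4-manifold `M` along a common contact seam (compact Stein domains, smooth embeddings covering `M`,
meeting exactly in the images of their boundaries, equal pushed-forward complex tangencies), and let
`K` be an open book on the boundary model `b₁.carrier ≅ ∂W₁` in Giroux form `α` for the
`J₁`-complex tangencies, positively framed, with planar page `P_n` and monodromy the arc datum `φ`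
(`HasPlanarMonodromy`).  THEN there are positive factorisations `A`, `B` of `φ` in the planar word
calculus — in-range syntactic curves with `monodromy n (positiveWord A) = φ = monodromy n
(positiveWord B)` — such that `W₁` is the planar Lefschetz body `X(P_n; A)`, `W₂` is `X(P_n; B)`,
and `M` is the planar word manifold of the block form `A · B̄ʳᵉᵛ`.  Users take
`(h : wendl_planarSteinBisection)`.
-- TODO(general form): Wendl's theorem for one arbitrary strong filling (deformation class of the
-- symplectic structure, blow-ups), of which this records only the diffeomorphism type of Stein
-- fillings and the closing of two of them.
[cite: Wendl2010, Thm. 1] [cite: EtnyreFuller2006, Prop. 12 and proof of Thm. 1 p. 8]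
[cite: Baykur2006, Thm. 5.1 (proof)] [cite: GompfStipsiczGSM1999, §8.2] -/
def wendl_planarSteinBisection : Prop :=
  ∀ (M : Type) [TopologicalSpace M] [T2Space M] [SecondCountableTopology M] [ChartedSpace (EuclideanSpace ℝ (Fin 4)) M]
    [IsManifold (𝓡 4) ∞ M]
    (W₁ : Type) [TopologicalSpace W₁] [ChartedSpace (EuclideanHalfSpace 4) W₁] [IsManifold (𝓡∂ 4) ∞ W₁]
    [CompactSpace W₁] (W₂ : Type) [TopologicalSpace W₂] [ChartedSpace (EuclideanHalfSpace 4) W₂]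
    [IsManifold (𝓡∂ 4) ∞ W₂] [CompactSpace W₂] (J₁ : SteinStructure W₁) (J₂ : SteinStructure W₂)
    (e₁ : W₁ → M) (e₂ : W₂ → M),
    Manifold.IsSmoothEmbedding (𝓡∂ 4) (𝓡 4) ∞ e₁ → Manifold.IsSmoothEmbedding (𝓡∂ 4) (𝓡 4) ∞ e₂ →
    range e₁ ∪ range e₂ = univ → range e₁ ∩ range e₂ = e₁ '' (𝓡∂ 4).boundary W₁ →
    range e₁ ∩ range e₂ = e₂ '' (𝓡∂ 4).boundary W₂ →
    (∀ w₁ w₂, e₁ w₁ = e₂ w₂ →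
      Submodule.map (mfderiv (𝓡∂ 4) (𝓡 4) e₁ w₁).toLinearMap (contactPlane J₁.J w₁) =
      Submodule.map (mfderiv (𝓡∂ 4) (𝓡 4) e₂ w₂).toLinearMap (contactPlane J₂.J w₂)) →
    ∀ (b₁ : BoundaryData (𝓡∂ 4) W₁ (𝓡 3)) (K : OpenBook b₁.carrier)
      (α : Kaehler.MForm (𝓡 3) b₁.carrier ℝ 1) (n : ℕ) (φ : ArcData n),
      K.IsGirouxForm (boundaryPlaneField J₁.J b₁) α → IsPositivelyFramed K α →
      K.HasPlanarMonodromy n φ →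
      ∃ A B : List PlanarCurve, (∀ c ∈ A ++ B, c.InRange n) ∧
        monodromy n (positiveWord A) = φ ∧ monodromy n (positiveWord B) = φ ∧
        IsPlanarLefschetzBody W₁ n (positiveWord A) ∧ IsPlanarLefschetzBody W₂ n (positiveWord B) ∧
        IsPlanarWordManifold M n (blockForm A B)

/-- **PALF ⇒ Stein, with the Kas boundary open book supporting the complex tangencies**
(Loi–Piergallini 2001, Thm. 1 / Akbulut–Ozbagci 2001, Thm. 5: *"a PALF admits a Stein
structure"*; Gay 2002, Prop. 2.8 / Etnyre 2006, Thm. 5.6: the boundary open book of the Lefschetz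
fibration supports the induced contact structure), read for planar bodies: if the compact `X` is
the planar Lefschetz body `X(P_n; A)` of a POSITIVE word of syntactic curves `g(c_[a,b])` with
nonempty in-page blocks `a ≤ b < n` (hence homotopically non-trivial in `P_n`: the fibration is
allowable; this is the orbit invariant `holes_of_reachable` of the word calculus), then `X` carries a Stein structure `S` such that, on ANY boundary datum `b` of `X`, the
complex tangencies `boundaryPlaneField S.J b` are supported by a PLANAR open book with `n + 1`
binding components (the Kas open book, page `P_n`, monodromy `T_A`).  Users take
`(h : planarLefschetzBody_stein_supported)`.
[cite: LoiPiergallini2001, Thm. 1] [cite: AkbulutOzbagci2001, Thm. 5] [cite: Gay2002, Prop. 2.8]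
[cite: Etnyre2006, Thm. 5.6] -/
def planarLefschetzBody_stein_supported : Prop :=
  ∀ (X : Type) [TopologicalSpace X] [T2Space X] [SecondCountableTopology X]
    [ChartedSpace (EuclideanHalfSpace 4) X] [IsManifold (𝓡∂ 4) ∞ X] [CompactSpace X]
    (n : ℕ) (A : List PlanarCurve), (∀ c ∈ A, c.a ≤ c.b ∧ c.b < n) →
    IsPlanarLefschetzBody X n (positiveWord A) →
    ∀ b : BoundaryData (𝓡∂ 4) X (𝓡 3), ∃ (S : SteinStructure X) (ob : OpenBook b.carrier),
      ob.IsPlanar ∧ ob.k = n + 1 ∧ ob.Supports (boundaryPlaneField S.J b)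

/-- **Baykur's Stein bisection of the closed model of a planar block word** (Baykur 2006, Thm. 5.1
and its proof, §5, pp. 12–14: *"`μ₊` defines a positive Lefschetz fibration on `X₊` and `μ₋` defines
a negative fibration on `X₋` … Noting that the NALF on `X₋` becomes a PALF on `−X₋`, both PALFs
induce the same open book decomposition on their boundaries … By [LP, AO], both `X₊` and `−X₋`
admit Stein structures. We will construct these Stein structures using Eliashberg's
characterization so that they match on the common boundary … the induced contact structures `ξ₊`
on `∂X₊` and `ξ₋` on `∂(−X₋)` are isotopic"*), for the planar page: if the Hausdorff
second-countable `C^∞` 4-manifold `M` is the planar word manifold of the block form `A · B̄ʳᵉᵛ` of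
two positive factorisations of ONE mapping class (`monodromy n (positiveWord A) = monodromy n
(positiveWord B)`, curves with nonempty in-page blocks `a ≤ b < n`), then `M` is a Stein bisection along a common contact seam — in
the exact shape of the hypothesis of route `ConvexBisection`: compact Stein pieces `(V₁, K₁)`,
`(V₂, K₂)` smoothly embedded, covering, meeting exactly in the images of their boundaries, equal
pushed-forward complex tangencies (the isotopic `ξ₊`, `ξ₋` made equal by a Gray isotopy absorbed
into `K₂`) — whose pieces are the planar Lefschetz bodies `X(P_n; A)` and `X(P_n; B)`.  Users take
`(h : baykur_planarSteinBisection)`.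
[cite: Baykur2006, Thm. 5.1 (proof, pp. 12–14)] [cite: LoiPiergallini2001, Thm. 1]
[cite: AkbulutOzbagci2001, Thm. 5] -/
def baykur_planarSteinBisection : Prop :=
  ∀ (M : Type) [TopologicalSpace M] [T2Space M] [SecondCountableTopology M] [ChartedSpace (EuclideanSpace ℝ (Fin 4)) M]
    [IsManifold (𝓡 4) ∞ M] (n : ℕ) (A B : List PlanarCurve), (∀ c ∈ A ++ B, c.a ≤ c.b ∧ c.b < n) →
    monodromy n (positiveWord A) = monodromy n (positiveWord B) →
    IsPlanarWordManifold M n (blockForm A B) →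
    ∃ (V₁ : Type) (_ : TopologicalSpace V₁) (_ : ChartedSpace (EuclideanHalfSpace 4) V₁)
      (_ : IsManifold (𝓡∂ 4) ∞ V₁) (_ : CompactSpace V₁)
      (V₂ : Type) (_ : TopologicalSpace V₂) (_ : ChartedSpace (EuclideanHalfSpace 4) V₂)
      (_ : IsManifold (𝓡∂ 4) ∞ V₂) (_ : CompactSpace V₂)
      (K₁ : SteinStructure V₁) (K₂ : SteinStructure V₂) (f₁ : V₁ → M) (f₂ : V₂ → M),
      Manifold.IsSmoothEmbedding (𝓡∂ 4) (𝓡 4) ∞ f₁ ∧ Manifold.IsSmoothEmbedding (𝓡∂ 4) (𝓡 4) ∞ f₂ ∧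
      range f₁ ∪ range f₂ = univ ∧ range f₁ ∩ range f₂ = f₁ '' (𝓡∂ 4).boundary V₁ ∧
      range f₁ ∩ range f₂ = f₂ '' (𝓡∂ 4).boundary V₂ ∧
      (∀ v₁ v₂, f₁ v₁ = f₂ v₂ →
        Submodule.map (mfderiv (𝓡∂ 4) (𝓡 4) f₁ v₁).toLinearMap (contactPlane K₁.J v₁) =
        Submodule.map (mfderiv (𝓡∂ 4) (𝓡 4) f₂ v₂).toLinearMap (contactPlane K₂.J v₂)) ∧
      IsPlanarLefschetzBody V₁ n (positiveWord A) ∧ IsPlanarLefschetzBody V₂ n (positiveWord B)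

end Literature.Geometry.Symplectic

end
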